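import Summits.AtomisticToContinuum.FouriersLaw.Theorems.EmbeddedDrudeMourreMourreDissolutionFrameworkAssembly
import Literature.MathematicalPhysics.KineticTheory.InfiniteChainPartialMomentumReversal
import Literature.MathematicalPhysics.KineticTheory.InfiniteChainCurrentMoments
import Literature.MathematicalPhysics.KineticTheory.InfiniteChainEnergyDensityMoments

/-!
# `EmbeddedDrudeMourre.MourreDissolution`, line `separable-vertex-faddeev-pair-sector` —
# helpers for stub `stub_symmetricFramework`, part 3/3: the reduction to hypothesis (H)

Item `stmt-AtomisticToContinuum-12594` (crux `MourreDissolution` of route `EmbeddedDrudeMourre`,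
sub-problem `FouriersLaw`), registered stub `stub_symmetricFramework` (S1) of the line skeleton
`Cruxes/MourreDissolution/Lines/separable_vertex_faddeev_pair_sector.lean`; sequel of parts 1/3
(`…FrameworkReflection`) and 2/3 (`…FrameworkAssembly`).

* `symmetricFramework_of` : the registered statement from ONE datum-level hypothesis (for the
  canonical dynamics and every `T > 0` a `ZeroWavenumberData` with Gibbs + superstable +
  `ι`-invariant state, `R`/`ι`-stable observables and autocorrelations continuous at `0`);
* `symmetricFramework_of_clustering` : **the registered statement, verbatim, from the scalar
  hypothesis (H)** = existence at every `T > 0` of a shift-invariant, superstable, `ι`-invariant DLR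
  state of `pinnedChain` in which the canonical flow has two scalar clustering properties
  (summable `x ↦ Cov(a, (b∘τ_x)∘φ_u)` and continuity at `0` of `t ↦ Σ_x Cov(a, (a∘τ_x)∘φ_t)`,
  `a, b ∈ {j₀, h₀}`). (H) is TRUE in print (Lebowitz–Presutti 1976 /
  Cassandro–Olivieri–Pellegrinotti–Presutti 1978: the transfer-operator state and its mixing;
  Buttà–Marchioro 2016 Thm 2.2: almost-linear light cone ⇒ space–time clustering) and is NOT in the
  tree at the time of writing (no theorem produces ANY `IsChainGibbsMeasure` of `pinnedChain`); it
  is to be registered as the infrastructure stub `stub_gibbsClustering` of the line.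
-/

noncomputable section

namespace Summit.AtomisticToContinuum.FouriersLaw.Theorems.MourreDissolution

open Filter Topology MeasureTheory ProbabilityTheory Set Function
open Literature.MathematicalPhysics.KineticTheory
open Literature.MathematicalPhysics.KineticTheory.HeatConduction

/-! ## §3. Every DLR state of the chain is invariant under the momentum reversal -/

/-- **Every DLR Gibbs state of an oscillator chain is invariant under the (global) momentum
reversal `R`** (at every temperature, for every chain): the tree proves invariance under the
reversal `R_S` of the momenta in any FINITE set `S` (DLR equation in `S`, the momenta being centred
Gaussian; `IsChainGibbsMeasure.map_momentumReversalOn`), and `R` agrees with `R_S` on every cylinder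
event based in `S`; cylinder events form a generating π-system.
[cite: LanfordLebowitzLieb1977, §4 remark (ii)] -/
theorem map_chainReversal_of_isChainGibbsMeasure {P : OscillatorChain} {T : ℝ}
    {μ : Measure ChainConfig} (hμ : P.IsChainGibbsMeasure T μ) : μ.map chainReversal = μ := by
  haveI := hμ.isProbabilityMeasure
  haveI : IsProbabilityMeasure (μ.map chainReversal) :=
    Measure.isProbabilityMeasure_map measurable_chainReversal.aemeasurable
  refine ext_of_generate_finite (measurableCylinders fun _ : ℤ => ℝ × ℝ)
    generateFrom_measurableCylinders.symm isPiSystem_measurableCylinders (fun A hA => ?_)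
    (by rw [measure_univ, measure_univ])
  obtain ⟨s, S, hS, rfl⟩ := (mem_measurableCylinders A).1 hA
  have hpre : chainReversal ⁻¹' cylinder s S = momentumReversalOn s ⁻¹' cylinder s S := by
    ext σ
    simp only [mem_preimage, mem_cylinder]
    have h : s.restrict (chainReversal σ) = s.restrict (momentumReversalOn s σ) := by
      funext i
      simp only [Finset.restrict, chainReversal_apply, momentumReversalOn_apply_mem σ i.2]
    rw [h]
  rw [Measure.map_apply measurable_chainReversal hS.cylinder, hpre,
    ← Measure.map_apply (measurable_momentumReversalOn s) hS.cylinder, hμ.map_momentumReversalOn s]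

/-- `R` preserves every DLR Gibbs state (the field `measurePreserving` of
`ZeroWavenumberData.HasMomentumReversal`, for any datum whose state is Gibbs). [folklore] -/
theorem measurePreserving_chainReversal_of_isChainGibbsMeasure {P : OscillatorChain} {T : ℝ}
    {μ : Measure ChainConfig} (hμ : P.IsChainGibbsMeasure T μ) :
    MeasurePreserving chainReversal μ μ :=
  ⟨measurable_chainReversal, map_chainReversal_of_isChainGibbsMeasure hμ⟩

/-! ## Reduction of the registered stub to the missing zero-wavenumber datum -/

/-- **The registered stub from one datum-level input.** The registered statement follows from ONE
input per `(ω₂, lam, β, γ, T)`, to be supplied for the canonical dynamics of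
`exists_symmetric_bmDynamics` (characterised by: carrier `bmGood`, measurable flow maps, identity
off `bmGood` — these three determine the flow): a zero-wavenumber datum `Z` whose state is a DLR
Gibbs state at `T` with the superstability estimate and is reflection invariant, whose observables
are stable under `R` and `ι`, and whose time autocorrelations `t ↦ ⟨a, a ∘ φ_t⟩₀` are continuous at
`t = 0` on local observables. Everything else — the dynamics and its exact `τ`/`R`/`ι` covariance,
`R`-invariance of the Gibbs state, stationarity, the a.e. commutation clauses, and strong
continuity of the whole Koopman group (Doyon 2022 Thm 4.11 (III),
`isStronglyContinuous_of_tendsto_form`) — is supplied by parts 1/3 and the tree.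
[cite: Doyon2022, §4.3 Thm 4.11] -/
theorem symmetricFramework_of
    (h : ∀ ω₂ lam β γ : ℝ, 0 < ω₂ → 0 < lam → 0 < β → 0 < γ →
      ∀ D : InfiniteChainDynamics (pinnedChain ω₂ lam β γ),
        D.carrier = (pinnedChain ω₂ lam β γ).bmGood →
        (∀ t : ℝ, Measurable (D.flow t)) →
        (∀ t : ℝ, ∀ σ ∉ (pinnedChain ω₂ lam β γ).bmGood, D.flow t σ = σ) →
        ∀ T : ℝ, 0 < T →
          ∃ Z : ZeroWavenumberData (pinnedChain ω₂ lam β γ) D,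
            (pinnedChain ω₂ lam β γ).IsChainGibbsMeasure T Z.μ ∧
            (pinnedChain ω₂ lam β γ).HasSuperstabilityEstimate Z.μ ∧
            MeasurePreserving (fun (σ : ℤ → ℝ × ℝ) (x : ℤ) => σ (-x)) Z.μ Z.μ ∧
            (∀ a : (ℤ → ℝ × ℝ) → ℝ, a ∈ Z.localObs → a ∘ chainReversal ∈ Z.localObs) ∧
            (∀ a : (ℤ → ℝ × ℝ) → ℝ, a ∈ Z.localObs →
              (a ∘ fun (σ : ℤ → ℝ × ℝ) (x : ℤ) => σ (-x)) ∈ Z.localObs) ∧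
            (∀ a : (ℤ → ℝ × ℝ) → ℝ, a ∈ Z.localObs →
              Tendsto (fun t : ℝ => Z.form a (a ∘ D.flow t)) (𝓝 0) (𝓝 (Z.form a a)))) :
    ∀ ω₂ lam β γ : ℝ, 0 < ω₂ → 0 < lam → 0 < β → 0 < γ →
      ∃ D : Literature.MathematicalPhysics.KineticTheory.HeatConduction.InfiniteChainDynamics
          (Literature.MathematicalPhysics.KineticTheory.HeatConduction.pinnedChain ω₂ lam β γ),
        D.carrier =
            (Literature.MathematicalPhysics.KineticTheory.HeatConduction.pinnedChain ω₂ lam β γ).bmGood ∧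
        ∀ T : ℝ, 0 < T →
          ∃ Z : Literature.MathematicalPhysics.KineticTheory.HeatConduction.ZeroWavenumberData
              (Literature.MathematicalPhysics.KineticTheory.HeatConduction.pinnedChain ω₂ lam β γ) D,
            (Literature.MathematicalPhysics.KineticTheory.HeatConduction.pinnedChain
                ω₂ lam β γ).IsChainGibbsMeasure T Z.μ ∧
            (Literature.MathematicalPhysics.KineticTheory.HeatConduction.pinnedChain
                ω₂ lam β γ).HasSuperstabilityEstimate Z.μ ∧
            Z.HasMomentumReversal ∧
            MeasureTheory.MeasurePreserving (fun (σ : ℤ → ℝ × ℝ) (x : ℤ) => σ (-x)) Z.μ Z.μ ∧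
            (∀ a : (ℤ → ℝ × ℝ) → ℝ, a ∈ Z.localObs →
              (a ∘ fun (σ : ℤ → ℝ × ℝ) (x : ℤ) => σ (-x)) ∈ Z.localObs) ∧
            (∀ t : ℝ, (fun (σ : ℤ → ℝ × ℝ) (x : ℤ) => σ (-x)) ∘ D.flow t =ᵐ[Z.μ]
              D.flow t ∘ fun (σ : ℤ → ℝ × ℝ) (x : ℤ) => σ (-x)) ∧
            (∀ ψ : Literature.MathematicalPhysics.KineticTheory.HeatConduction.ZeroWavenumberSpace Z,
              Continuous fun t : ℝ => Z.koopman t ψ) := by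
  intro ω₂ lam β γ hω hl hβ hγ
  obtain ⟨D, hD, hm, hid, -, -, -, hrev, hrefl⟩ := exists_symmetric_bmDynamics ω₂ lam β γ hω.le hl hβ
  refine ⟨D, hD, fun T hT => ?_⟩
  obtain ⟨Z, hG, hSS, hιμ, hRobs, hιobs, hcont⟩ := h ω₂ lam β γ hω hl hβ hγ D hD hm hid T hT
  refine ⟨Z, hG, hSS, ⟨measurePreserving_chainReversal_of_isChainGibbsMeasure hG, hRobs, fun t =>
    Eventually.of_forall fun σ => congrFun (hrev t) σ⟩, hιμ, hιobs,
    fun t => Eventually.of_forall fun σ => congrFun (hrefl t) σ, ?_⟩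
  exact Z.toFluctuationDynamics.isStronglyContinuous_of_tendsto_form fun a ha => hcont a ha

/-! ## The registered stub from the scalar clustering hypothesis (H) -/

/-- **The registered stub from the scalar clustering hypothesis (H).** (H) says: for the canonical
dynamics and every `T > 0` there is a shift-invariant, superstable, reflection-invariant DLR state
`μ` in which `x ↦ Cov_μ(a, (b∘τ_x)∘φ_u)` is summable (`a, b ∈ {j₀, h₀}`, every `u`) and
`t ↦ Σ_x Cov_μ(a, (a∘τ_x)∘φ_t)` is continuous at `0` (`a ∈ {j₀, h₀}`). In print: Lebowitz–Presutti
1976 / Cassandro–Olivieri–Pellegrinotti–Presutti 1978 (the state, by the transfer operator; its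
mixing), Buttà–Marchioro 2016 Thm 2.2 (almost-linear light cone ⇒ space–time clustering). NOT in the
tree at the time of writing; everything else is supplied by parts 1/3, 2/3 and the tree
(`R`-invariance of `μ`: `measurePreserving_chainReversal_of_isChainGibbsMeasure`; `D`-invariance of
`μ`: `OscillatorChain.exists_bmDynamics`; `j₀, h₀ ∈ L²(μ)`: the superstability moments
`memLp_bondCurrentZ_pinnedChain`, `memLp_energyDensityZ_pinnedChain`).
[cite: ButtaMarchioro2016, §2 Thm 2.1–2.2] -/
theorem symmetricFramework_of_clustering : (∀ ω₂ lam β γ : ℝ, 0 < ω₂ → 0 < lam → 0 < β → ∀ T : ℝ, 0 < T → ∀ D : Literature.MathematicalPhysics.KineticTheory.HeatConduction.InfiniteChainDynamics (Literature.MathematicalPhysics.KineticTheory.HeatConduction.pinnedChain ω₂ lam β γ), D.carrier = (Literature.MathematicalPhysics.KineticTheory.HeatConduction.pinnedChain ω₂ lam β γ).bmGood → (∀ t : ℝ, Measurable (D.flow t)) → (∀ t : ℝ, ∀ σ ∉ (Literature.MathematicalPhysics.KineticTheory.HeatConduction.pinnedChain ω₂ lam β γ).bmGood, D.flow t σ =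 σ) → ∃ μ : MeasureTheory.Measure Literature.MathematicalPhysics.KineticTheory.HeatConduction.ChainConfig, (Literature.MathematicalPhysics.KineticTheory.HeatConduction.pinnedChain ω₂ lam β γ).IsChainGibbsMeasure T μ ∧ Literature.MathematicalPhysics.KineticTheory.HeatConduction.IsShiftInvariant μ ∧ (Literature.MathematicalPhysics.KineticTheory.HeatConduction.pinnedChain ω₂ lam β γ).HasSuperstabilityEstimate μ ∧ μ.map (fun (σ : ℤ → ℝ × ℝ) (x : ℤ) => σ (-x)) = μ ∧ (∀ a ∈ ({fun σ => (Literature.MathematicalPhysics.KineticTheory.HeatConduction.pinnedChain ω₂ lam β γ).bondCurrentZ σ 0, fun σ => (Literature.MathematicalPhysics.KineticTheory.HeatConduction.pinnedChain ω₂ lam β γ).energyDensityZ σ 0} : Set (Literature.MathematicalPhysics.KineticTheory.HeatConduction.ChainConfig → ℝ)), ∀ b ∈ ({fun σ => (Literature.MathematicalPhysics.KineticTheory.HeatConduction.pinnedChain ω₂ lam β γ).bondCurrentZ σ 0, fun σ => (Literature.MathematicalPhysics.KineticTheory.HeatConduction.pinnedChain ω₂ lam β γ).energyDensityZ σ 0}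 : Set (Literature.MathematicalPhysics.KineticTheory.HeatConduction.ChainConfig → ℝ)), ∀ u : ℝ, Summable fun x : ℤ => ProbabilityTheory.covariance a ((b ∘ Literature.MathematicalPhysics.KineticTheory.HeatConduction.chainShift x) ∘ D.flow u) μ) ∧ (∀ a ∈ ({fun σ => (Literature.MathematicalPhysics.KineticTheory.HeatConduction.pinnedChain ω₂ lam β γ).bondCurrentZ σ 0, fun σ => (Literature.MathematicalPhysics.KineticTheory.HeatConduction.pinnedChain ω₂ lam β γ).energyDensityZ σ 0} : Set (Literature.MathematicalPhysics.KineticTheory.HeatConduction.ChainConfig → ℝ)), ContinuousAt (fun t : ℝ => ∑' x : ℤ, ProbabilityTheory.covariance a ((a ∘ Literature.MathematicalPhysics.KineticTheory.HeatConduction.chainShift x) ∘ D.flow t) μ) 0)) → ∀ ω₂ lam β γ : ℝ, 0 < ω₂ → 0 < lam → 0 < β → 0 < γ → ∃ D : Literature.MathematicalPhysics.KineticTheory.HeatConduction.InfiniteChainDynamics (Literature.MathematicalPhysics.KineticTheory.HeatConduction.pinnedChain ω₂ lam β γ), D.carrier = (Literature.MathematicalPhysics.KineticTheory.HeatConduction.pinnedChain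 ω₂ lam β γ).bmGood ∧ ∀ T : ℝ, 0 < T → ∃ Z : Literature.MathematicalPhysics.KineticTheory.HeatConduction.ZeroWavenumberData (Literature.MathematicalPhysics.KineticTheory.HeatConduction.pinnedChain ω₂ lam β γ) D, (Literature.MathematicalPhysics.KineticTheory.HeatConduction.pinnedChain ω₂ lam β γ).IsChainGibbsMeasure T Z.μ ∧ (Literature.MathematicalPhysics.KineticTheory.HeatConduction.pinnedChain ω₂ lam β γ).HasSuperstabilityEstimate Z.μ ∧ Z.HasMomentumReversal ∧ MeasureTheory.MeasurePreserving (fun (σ : ℤ → ℝ × ℝ) (x : ℤ) => σ (-x)) Z.μ Z.μ ∧ (∀ a : (ℤ → ℝ × ℝ) → ℝ, a ∈ Z.localObs → (a ∘ fun (σ : ℤ → ℝ × ℝ) (x : ℤ) => σ (-x)) ∈ Z.localObs) ∧ (∀ t : ℝ, (fun (σ : ℤ → ℝ × ℝ) (x : ℤ) => σ (-x)) ∘ D.flow t =ᵐ[Z.μ] D.flow t ∘ fun (σ : ℤ → ℝ × ℝ) (x : ℤ) => σ (-x)) ∧ (∀ ψ : Literature.MathematicalPhysics.KineticTheory.HeatConduction.ZeroWavenumberSpace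 Z, Continuous fun t : ℝ => Z.koopman t ψ) := by
  intro h ω₂ lam β γ hω hl hβ _hγ
  obtain ⟨D, hD, hm, hid, hgrp, hpresAll, hsh, hrev, hrefl⟩ :=
    exists_symmetric_bmDynamics ω₂ lam β γ hω.le hl hβ
  refine ⟨D, hD, fun T hT => ?_⟩
  obtain ⟨μ, hG, hshift, hSS, hιmap, hsum, hcont⟩ := h ω₂ lam β γ hω hl hβ T hT D hD hm hid
  haveI := hG.isProbabilityMeasure
  have hpres : D.PreservesMeasure μ := hpresAll T μ hG hSS
  -- global `φ_0 = id` and group law (identity off `bmGood`)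
  have h0 : D.flow 0 = id := by
    funext σ
    by_cases hσ : σ ∈ (pinnedChain ω₂ lam β γ).bmGood
    · exact D.flow_zero σ (by rw [hD]; exact hσ)
    · exact hid 0 σ hσ
  have hgrp' : ∀ t s : ℝ, D.flow (t + s) = D.flow t ∘ D.flow s := by
    intro t s
    funext σ
    by_cases hσ : σ ∈ (pinnedChain ω₂ lam β γ).bmGood
    · exact hgrp t s σ hσ
    · rw [comp_apply, hid (t + s) σ hσ, hid s σ hσ, hid t σ hσ]
  obtain ⟨Z, hZμ, hMR, hιV, hιflow, hsc⟩ :=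
    exists_zeroWavenumberData_of_clustering _ D (pinnedChain_V_neg ω₂ lam β γ) h0 hgrp' hsh hrev
      hrefl μ hpres (hshift.measurePreserving_chainShift)
      (measurePreserving_chainReversal_of_isChainGibbsMeasure hG)
      (OscillatorChain.memLp_bondCurrentZ_pinnedChain γ hω.le hl.le hβ hSS 0 (by norm_num))
      (OscillatorChain.memLp_energyDensityZ_pinnedChain γ hω.le hl.le hβ.le hSS 0 (by norm_num))
      hsum hcont
  refine ⟨Z, by rw [hZμ]; exact hG, by rw [hZμ]; exact hSS, hMR, ?_, hιV, hιflow, hsc⟩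
  rw [hZμ]
  exact ⟨measurable_reflect, hιmap⟩

end Summit.AtomisticToContinuum.FouriersLaw.Theorems.MourreDissolution

end
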